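import Summits.ResolutionOfSingularities.ResolutionOfSingularities.Theorems.PAlterationPialtFrobenius
import HarnessLib

/-!
# `Pialt` (crux stmt-ResolutionOfSingularities-0555): the Frobenius trick over F-finite fields

Companion to `PAlterationPialtFrobenius.lean` (landed `--supports stmt-ResolutionOfSingularities-0555`;
does not close the item), which proves Frobenius domination, the ASCENT of the conclusion of
`Pialt` along finite radicial covers of normal varieties, and the known case "finite radicial
covers of resolvable normal varieties" over PERFECT fields. The only input that used perfectness
was the finiteness of the Frobenius power `F_Y^e` (`isFinite_powEndo`). Here the same is done
over **F-finite fields** `K` (`[K : K^p] < ∞`, rendered as: the Frobenius `x ↦ x^p` of `K` is a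
ring homomorphism of finite type), which is exactly Temkin's hypothesis (Temkin 2013,
Rem. 1.3.5(i): "if `[k : k^p] < ∞` then `h` is finite") and covers the imperfect fields of
arithmetic interest (`𝔽_p(t₁, …, tₙ)`, function fields over perfect fields, their finite
extensions):

* `isFinite_powEndo_of_frobenius_finiteType` — for `X` locally of finite type over an F-finite
  field of characteristic `p`, every power `F_X^e` of the absolute Frobenius is FINITE;
* `exists_frobeniusCover_of_frobenius_finiteType` — Frobenius domination of finite radicial
  covers `X → Y` of normal varieties over F-finite fields (`N ≅ Y`, `N → X` finite radicial
  surjective);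
* `pialtConclusion_of_finite_universallyInjective_surjective_of_frobenius_finiteType` — ascent
  of the conclusion of `Pialt` along such covers over F-finite fields;
* `pialtConclusion_of_picoverShape_of_frobenius_finiteType` — the `Picover` class (finite radicial
  covers of regular varieties) satisfies `Pialt` over every F-finite field;
* `pialtConclusion_reduced_baseChange_iff` — over an F-finite field the conclusion of `Pialt` at a
  normal `X / k` is EQUIVALENT to the conclusion at the reduced base change `(X ⊗_k k')_red` for
  every finite purely inseparable `k'/k`: the conclusion of `Pialt` is insensitive to the
  inseparable ground-field extensions under which regularity itself is unstable (barrier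
  `Literature.Barriers.ResolutionOfSingularities.InseparableBaseChange`).

Sources: M. Temkin, J. Algebra 373 (2013), Rem. 1.3.5(i); E. Kunz, *Characterizations of regular
local rings of characteristic p*, Amer. J. Math. 91 (1969) (F-finiteness); Stacks Project,
Tags 0CNF, 0CC6.
-/

noncomputable section

set_option linter.dupNamespace false -- mandated namespace of this single-conjunct summit

namespace Summit.ResolutionOfSingularities.ResolutionOfSingularities.Theorems

open CategoryTheory AlgebraicGeometry TopologicalSpace Opposite
open Literature.AlgebraicGeometry.Resolution Literature.AlgebraicGeometry.Motives
open Literature.AlgebraicGeometry.Motives.RatFn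
open Summit.ResolutionOfSingularities.ResolutionOfSingularities.Theorems.Picover.FunctionFieldRadicial

universe u

/-! ## Finiteness of Frobenius powers over an F-finite field -/

section FFinite

variable (p : ℕ) [Fact p.Prime] {K : Type u} [Field K] [CharP K p]

/-- Over an F-finite field (Frobenius of finite type), every iterate of the Frobenius is of finite
type. [folklore] -/
theorem finiteType_iterateFrobenius (hK : (frobenius K p).FiniteType) (N : ℕ) :
    (iterateFrobenius K p N).FiniteType := by
  induction N with
  | zero =>
    have h0 : iterateFrobenius K p 0 = RingHom.id K := by
      ext x
      simp
    rw [h0]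
    exact RingHom.FiniteType.id K
  | succ N ih =>
    have hs : iterateFrobenius K p (N + 1) = (frobenius K p).comp (iterateFrobenius K p N) := by
      ext x
      simp [iterateFrobenius_def, frobenius_def, pow_succ, pow_mul]
    rw [hs]
    exact hK.comp ih

/-- A perfect field is F-finite: its Frobenius is surjective, hence of finite type. [folklore] -/
theorem frobenius_finiteType_of_perfectField [PerfectField K] : (frobenius K p).FiniteType :=
  haveI : PerfectRing K p := PerfectField.toPerfectRing p
  RingHom.FiniteType.of_surjective _ (surjective_frobenius K p)

variable {X : Scheme.{u}} (f : X ⟶ Spec (.of K))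

/-- Over an F-finite field of characteristic `p`, the `p^N`-th power endomorphism of a scheme
locally of finite type is locally of finite type (`F_X ≫ f = f ≫ F_{Spec K}` with `F_{Spec K}` of
finite type). [folklore] -/
theorem locallyOfFiniteType_powEndo_of_frobenius_finiteType [LocallyOfFiniteType f]
    (hK : (frobenius K p).FiniteType) (N : ℕ)
    (hadd : ∀ (U : X.Opens) (a b : Γ(X, U)), (a + b) ^ p ^ N = a ^ p ^ N + b ^ p ^ N) :
    LocallyOfFiniteType (powEndo X (p ^ N) (pow_ne_zero N (Fact.out : p.Prime).ne_zero) hadd) := by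
  have hK0 : ((p : ℕ) : Γ(Spec (CommRingCat.of K), ⊤)) = 0 :=
    natCast_appTop_eq_zero p (𝟙 (Spec (.of K)))
  have haddK := add_pow_sections p hK0 N
  have hKadd : ∀ a b : K, (a + b) ^ p ^ N = a ^ p ^ N + b ^ p ^ N := fun a b =>
    add_pow_char_pow a b p N
  haveI : LocallyOfFiniteType
      (powEndo (Spec (.of K)) (p ^ N) (pow_ne_zero N (Fact.out : p.Prime).ne_zero) haddK) := by
    rw [powEndo_Spec (p ^ N) _ K hKadd haddK,
      HasRingHomProperty.Spec_iff (P := @LocallyOfFiniteType)]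
    have he : powRingHom K (p ^ N) (pow_ne_zero N (Fact.out : p.Prime).ne_zero) hKadd =
        iterateFrobenius K p N := by
      ext x
      simp [powRingHom_apply, iterateFrobenius_def]
    change (powRingHom K (p ^ N) (pow_ne_zero N (Fact.out : p.Prime).ne_zero) hKadd).FiniteType
    rw [he]
    exact finiteType_iterateFrobenius p hK N
  haveI : LocallyOfFiniteType (powEndo X (p ^ N) (pow_ne_zero N (Fact.out : p.Prime).ne_zero)
      hadd ≫ f) := by
    rw [powEndo_comp (p ^ N) _ hadd f haddK]
    infer_instance
  exact locallyOfFiniteType_of_comp _ f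

/-- **Finiteness of Frobenius powers over an F-finite field**: for `X` locally of finite type
over a field `K` of characteristic `p` whose Frobenius is of finite type (`[K : K^p] < ∞`), the
`p^N`-th power endomorphism of `X` is a finite morphism (integral and locally of finite type).
[cite: Temkin2013, Rem. 1.3.5(i)] -/
theorem isFinite_powEndo_of_frobenius_finiteType [LocallyOfFiniteType f]
    (hK : (frobenius K p).FiniteType) (N : ℕ)
    (hadd : ∀ (U : X.Opens) (a b : Γ(X, U)), (a + b) ^ p ^ N = a ^ p ^ N + b ^ p ^ N) :
    IsFinite (powEndo X (p ^ N) (pow_ne_zero N (Fact.out : p.Prime).ne_zero) hadd) := by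
  rw [IsFinite.iff_isIntegralHom_and_locallyOfFiniteType]
  exact ⟨isIntegralHom_powEndo X (p ^ N) _ hadd,
    locallyOfFiniteType_powEndo_of_frobenius_finiteType p f hK N hadd⟩

end FFinite

/-! ## Frobenius domination over an F-finite field -/

/-- **Frobenius domination of a finite radicial cover over an F-finite field** (Temkin 2013,
Rem. 1.3.5(i)): for `h : X → Y` finite, universally injective and dominant between integral
schemes, `Y` normal and locally of finite type over a field `K` of characteristic `p` with
Frobenius of finite type, some integral `N ≅ Y` maps finitely, universally injectively and
surjectively onto `X`. Same construction as `exists_frobeniusCover_of_finite_universallyInjective`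
(perfect case), with `isFinite_powEndo_of_frobenius_finiteType`. [cite: Temkin2013, Rem. 1.3.5(i)] -/
theorem exists_frobeniusCover_of_frobenius_finiteType (p : ℕ) [Fact p.Prime] (K : Type)
    [Field K] [CharP K p] (hK : (frobenius K p).FiniteType) (X Y : Scheme.{0}) [IsIntegral X]
    [IsIntegral Y] (f : Y ⟶ Spec (.of K)) [LocallyOfFiniteType f] (h : X ⟶ Y) [IsFinite h]
    [UniversallyInjective h] [IsDominant h] (hYn : ∀ y : Y, IsIntegrallyClosed (Y.presheaf.stalk y)) :
    ∃ (N : Scheme.{0}) (ψ : N ⟶ X) (φ : N ⟶ Y), IsIntegral N ∧ IsIso φ ∧ IsFinite ψ ∧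
      UniversallyInjective ψ ∧ Function.Surjective ψ.base := by
  have hp : p.Prime := Fact.out
  -- characteristic `p` on `Y` and on `K(Y)`
  have hpY : (p : Γ(Y, ⊤)) = 0 := natCast_appTop_eq_zero p f
  haveI : CharP Y.functionField p := by
    haveI : Nonempty (⊤ : Y.Opens) := ⟨⟨genericPoint Y, trivial⟩⟩
    exact (((Y.germToFunctionField ⊤).hom.comp
      ((f.appTop).hom.comp (Scheme.ΓSpecIso (.of K)).inv.hom)).charP_iff_charP p).mp inferInstance
  haveI : ExpChar Y.functionField p := ExpChar.prime hp
  -- `K(X)/K(Y)` is finite purely inseparable, of exponent `p^e`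
  obtain ⟨_, ⟨V, hVaff, rfl⟩, hξV, -⟩ :=
    Y.isBasis_affineOpens.exists_subset_of_mem_open (Set.mem_univ (genericPoint Y)) isOpen_univ
  haveI : FiniteDimensional Y.functionField (FunctionFieldOver h) :=
    FunctionFieldOver.finiteDimensional h hVaff hξV
  haveI : IsPurelyInseparable Y.functionField (FunctionFieldOver h) :=
    stub_functionFieldRadicial X Y h
  set e := IsPurelyInseparable.exponent Y.functionField (FunctionFieldOver h) with he
  let τ : FunctionFieldOver h →+* Y.functionField :=
    IsPurelyInseparable.iterateFrobenius Y.functionField (FunctionFieldOver h) p le_rfl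
  have hτ : ∀ y : Y.functionField,
      τ (algebraMap Y.functionField (FunctionFieldOver h) y) = y ^ p ^ e := fun y =>
    IsPurelyInseparable.iterateFrobenius_algebraMap (FunctionFieldOver h) p le_rfl y
  -- the finite Frobenius power `F = F_Y^e`
  have hadd := add_pow_sections p hpY e
  set F := powEndo Y (p ^ e) (pow_ne_zero e hp.ne_zero) hadd with hFdef
  haveI : IsFinite F := isFinite_powEndo_of_frobenius_finiteType p f hK e hadd
  haveI : UniversallyInjective F := universallyInjective_powEndo Y p e hadd hpY
  haveI : Surjective F := ⟨fun x => ⟨x, rfl⟩⟩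
  have hF : ∀ y : Y.functionField, RatFn.functionFieldMap F y = y ^ p ^ e :=
    functionFieldMap_powEndo Y (p ^ e) _ hadd
  -- `L := K(Y)` over `K(Y)` via `F^♯`; `N := Y^L ≅ Y`
  obtain ⟨φ, hφ, -, -⟩ := exists_isIso_comparison_of_normal K Y Y f F hYn
  -- `Spec L → X`, `Spec` of `τ : K(X) → K(Y) = L`
  let τ' : CommRingCat.of X.functionField ⟶ CommRingCat.of (FunctionFieldOver F) :=
    CommRingCat.ofHom τ
  let f₁ : Spec (.of (FunctionFieldOver F)) ⟶ X := Spec.map τ' ≫ fromSpecFunctionField X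
  have H : fromSpecExtension Y (FunctionFieldOver F) = f₁ ≫ h := by
    have h1 : f₁ ≫ h = Spec.map τ' ≫ fromSpecExtension Y (FunctionFieldOver h) := by
      simp only [f₁, Category.assoc,
        Picover.OfNormalizationIn.fromSpecExtension_functionFieldOver h]
    rw [h1]
    change Spec.map (CommRingCat.ofHom (algebraMap Y.functionField (FunctionFieldOver F))) ≫
        fromSpecFunctionField Y =
      Spec.map τ' ≫ Spec.map (CommRingCat.ofHom
        (algebraMap Y.functionField (FunctionFieldOver h))) ≫ fromSpecFunctionField Y
    rw [← Category.assoc, ← Spec.map_comp]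
    congr 2
    ext y
    change RatFn.functionFieldMap F y = τ (algebraMap Y.functionField (FunctionFieldOver h) y)
    rw [hF, hτ]
  let ψ : normalizationIn Y (FunctionFieldOver F) ⟶ X :=
    (fromSpecExtension Y (FunctionFieldOver F)).normalizationDesc f₁ h H
  have hψh : ψ ≫ h = normalizationInι Y (FunctionFieldOver F) :=
    (fromSpecExtension Y (FunctionFieldOver F)).normalizationDesc_comp f₁ h H
  -- `ψ ≫ h = ι` is finite, radicial and surjective, hence so is `ψ`
  haveI : FiniteDimensional Y.functionField (FunctionFieldOver F) :=
    FunctionFieldOver.finiteDimensional F hVaff hξV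
  haveI : IsPurelyInseparable Y.functionField (FunctionFieldOver F) :=
    stub_functionFieldRadicial Y Y F
  haveI : IsFinite (normalizationInι Y (FunctionFieldOver F)) :=
    isFinite_normalizationInι Y (FunctionFieldOver F) f
  haveI : UniversallyInjective (normalizationInι Y (FunctionFieldOver F)) :=
    universallyInjective_normalizationInι_of_isPurelyInseparable Y (FunctionFieldOver F) p hYn
  have hψfin : IsFinite ψ := by
    have h1 : IsFinite (ψ ≫ h) := by rw [hψh]; infer_instance
    exact IsFinite.comp_iff.mp h1
  have hψui : UniversallyInjective ψ := by
    haveI : UniversallyInjective (ψ ≫ h) := by rw [hψh]; infer_instance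
    exact universallyInjective_of_comp ψ h
  have hψsurj : Function.Surjective ψ.base := by
    refine surjective_of_comp_of_injective ψ h ?_ h.injective
    rw [hψh]
    exact (surjective_normalizationInι Y (FunctionFieldOver F)).surj
  exact ⟨normalizationIn Y (FunctionFieldOver F), ψ, φ, inferInstance, hφ, hψfin, hψui, hψsurj⟩

/-! ## Ascent of the conclusion of `Pialt` over F-finite fields -/

/-- **Over an F-finite field, the conclusion of `Pialt` ascends along finite radicial surjective
morphisms onto normal varieties** (as in the perfect case,
`pialtConclusion_of_finite_universallyInjective_surjective_perfectField`). [cite: Temkin2013, Rem. 1.3.5(i)] -/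
theorem pialtConclusion_of_finite_universallyInjective_surjective_of_frobenius_finiteType (p : ℕ)
    [Fact p.Prime] (K : Type) [Field K] [CharP K p] (hK : (frobenius K p).FiniteType)
    (X Y : Scheme.{0}) [IsIntegral X] [IsIntegral Y] (f : Y ⟶ Spec (.of K))
    [LocallyOfFiniteType f] (h : X ⟶ Y) [IsFinite h] [UniversallyInjective h]
    (hsurj : Function.Surjective h.base) (hYn : ∀ y : Y, IsIntegrallyClosed (Y.presheaf.stalk y))
    (hY : ∃ (Y' : Scheme.{0}) (g : Y' ⟶ Y), IsProper g ∧ IsIntegral Y' ∧ Scheme.IsRegular Y' ∧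
      Function.Surjective g.base ∧ ∃ U : Y.Opens, Dense (U : Set Y) ∧ IsFinite (g ∣_ U) ∧
        UniversallyInjective (g ∣_ U)) :
    ∃ (X' : Scheme.{0}) (g : X' ⟶ X), IsProper g ∧ IsIntegral X' ∧ Scheme.IsRegular X' ∧
      Function.Surjective g.base ∧ ∃ U : X.Opens, Dense (U : Set X) ∧ IsFinite (g ∣_ U) ∧
        UniversallyInjective (g ∣_ U) := by
  haveI : IsDominant h := ⟨hsurj.denseRange⟩
  obtain ⟨N, ψ, φ, hN, hφ, hψfin, hψui, hψsurj⟩ :=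
    exists_frobeniusCover_of_frobenius_finiteType p K hK X Y f h hYn
  haveI := hN; haveI := hφ; haveI := hψfin; haveI := hψui
  haveI : Surjective ψ := ⟨hψsurj⟩
  have hN' := pialtConclusion_of_finite_universallyInjective_surjective (inv φ) hY
  exact pialtConclusion_of_finite_universallyInjective_surjective ψ hN'

/-- **Finite radicial covers of resolvable normal varieties over F-finite fields satisfy
`Pialt`.** [cite: Temkin2013, Rem. 1.3.5(i)–(iii)] -/
theorem pialtConclusion_of_radicialCover_of_hasResolution_of_frobenius_finiteType (p : ℕ)
    [Fact p.Prime] (K : Type) [Field K] [CharP K p] (hK : (frobenius K p).FiniteType)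
    (X Y : Scheme.{0}) [IsIntegral X] [IsIntegral Y] (f : Y ⟶ Spec (.of K))
    [LocallyOfFiniteType f] (h : X ⟶ Y) [IsFinite h] [UniversallyInjective h]
    (hsurj : Function.Surjective h.base) (hYn : ∀ y : Y, IsIntegrallyClosed (Y.presheaf.stalk y))
    (hres : Scheme.HasResolution Y) :
    ∃ (X' : Scheme.{0}) (g : X' ⟶ X), IsProper g ∧ IsIntegral X' ∧ Scheme.IsRegular X' ∧
      Function.Surjective g.base ∧ ∃ U : X.Opens, Dense (U : Set X) ∧ IsFinite (g ∣_ U) ∧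
        UniversallyInjective (g ∣_ U) :=
  pialtConclusion_of_finite_universallyInjective_surjective_of_frobenius_finiteType p K hK X Y f
    h hsurj hYn (pialtConclusion_of_hasResolution Y hres)

/-- **The `Picover` shape over an F-finite field**: for `Y` regular integral locally of finite type
over a field of characteristic `p` with Frobenius of finite type and `g : X → Y` finite,
universally injective, surjective with `X` integral, the conclusion of `Pialt` holds at `X`.
[cite: Temkin2013, Rem. 1.3.5(iii)] -/
theorem pialtConclusion_of_picoverShape_of_frobenius_finiteType (p : ℕ) [Fact p.Prime]
    (K : Type) [Field K] [CharP K p] (hK : (frobenius K p).FiniteType) (Y X : Scheme.{0})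
    (f : Y ⟶ Spec (.of K)) (g : X ⟶ Y) [LocallyOfFiniteType f] [IsIntegral Y]
    (hreg : Scheme.IsRegular Y) [IsIntegral X] [IsFinite g] [UniversallyInjective g]
    (hsurj : Function.Surjective g.base) :
    ∃ (X' : Scheme.{0}) (g' : X' ⟶ X), IsProper g' ∧ IsIntegral X' ∧ Scheme.IsRegular X' ∧
      Function.Surjective g'.base ∧ ∃ U : X.Opens, Dense (U : Set X) ∧ IsFinite (g' ∣_ U) ∧
        UniversallyInjective (g' ∣_ U) :=
  pialtConclusion_of_finite_universallyInjective_surjective_of_frobenius_finiteType p K hK X Y f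
    g hsurj (fun y => haveI := hreg y; isIntegrallyClosed_of_isRegularLocalRing (Y.presheaf.stalk y))
    (pialtConclusion_of_isRegular Y hreg)

/-! ## `Pialt` is insensitive to finite purely inseparable ground-field extensions (F-finite base) -/

open Scheme.IdealSheafData in
/-- **Over an F-finite field, the conclusion of `Pialt` at a normal variety `X / k` is equivalent
to the conclusion at the reduced base change `(X ⊗_k k')_red` for every finite purely inseparable
extension `k'/k`.** Here `(X ⊗_k k')_red → X` is finite, universally injective and surjective with
integral source (`isIntegral_reduced_pullback` &c.), so `⇐` is the unconditional descent
(`pialtConclusion_of_finite_universallyInjective_surjective`) and `⇒` the F-finite ascent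
(`pialtConclusion_of_finite_universallyInjective_surjective_of_frobenius_finiteType`). Regularity
itself is NOT stable under such base changes (barrier
`Literature.Barriers.ResolutionOfSingularities.InseparableBaseChange`); the conclusion of `Pialt`
is. [cite: Temkin2013, Rem. 1.3.5(i)] -/
theorem pialtConclusion_reduced_baseChange_iff (p : ℕ) [Fact p.Prime] (k k' : Type) [Field k]
    [Field k'] [CharP k p] [CharP k' p] [Algebra k k'] [FiniteDimensional k k']
    [IsPurelyInseparable k k'] (hK : (frobenius k p).FiniteType) (X : Scheme.{0}) [IsIntegral X]
    (f : X ⟶ Spec (.of k)) [LocallyOfFiniteType f]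
    (hN : ∀ x : X, IsIntegrallyClosed (X.presheaf.stalk x)) :
    (∃ (Z' : Scheme.{0}) (g : Z' ⟶ (vanishingIdeal (⊤ : Closeds
        ↑(Limits.pullback (Spec.map (CommRingCat.ofHom (algebraMap k k'))) f))).subscheme),
      IsProper g ∧ IsIntegral Z' ∧ Scheme.IsRegular Z' ∧ Function.Surjective g.base ∧
        ∃ U : (vanishingIdeal (⊤ : Closeds
          ↑(Limits.pullback (Spec.map (CommRingCat.ofHom (algebraMap k k'))) f))).subscheme.Opens,
          Dense (U : Set ↥(vanishingIdeal (⊤ : Closeds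
            ↑(Limits.pullback (Spec.map (CommRingCat.ofHom (algebraMap k k'))) f))).subscheme) ∧
            IsFinite (g ∣_ U) ∧ UniversallyInjective (g ∣_ U)) ↔
    (∃ (X' : Scheme.{0}) (g : X' ⟶ X), IsProper g ∧ IsIntegral X' ∧ Scheme.IsRegular X' ∧
      Function.Surjective g.base ∧ ∃ U : X.Opens, Dense (U : Set X) ∧ IsFinite (g ∣_ U) ∧
        UniversallyInjective (g ∣_ U)) := by
  haveI : ExpChar k p := ExpChar.prime Fact.out
  set F := Spec.map (CommRingCat.ofHom (algebraMap k k')) with hFdef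
  -- `Spec k' → Spec k` is finite, universally injective and surjective
  haveI : IsFinite F := by
    rw [hFdef, IsFinite.SpecMap_iff]
    exact (RingHom.finite_algebraMap (A := k) (B := k')).mpr inferInstance
  haveI : UniversallyInjective F :=
    universallyInjective_specMap_field_of_pow_mem (algebraMap k k') p fun x =>
      IsPurelyInseparable.pow_mem k p x
  haveI : Surjective F := surjective_specMap_field (algebraMap k k')
  -- the reduced base change `Z = (X ⊗_k k')_red → X`
  set ι := (vanishingIdeal (⊤ : Closeds ↑(Limits.pullback F f))).subschemeι with hιdef
  haveI : IsIntegral (vanishingIdeal (⊤ : Closeds ↑(Limits.pullback F f))).subscheme :=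
    isIntegral_reduced_pullback F f
  haveI : IsFinite (ι ≫ Limits.pullback.snd F f) := isFinite_reduced_pullback_snd F f
  haveI : UniversallyInjective (ι ≫ Limits.pullback.snd F f) :=
    universallyInjective_reduced_pullback_snd F f
  haveI : Surjective (ι ≫ Limits.pullback.snd F f) := surjective_reduced_pullback_snd F f
  refine ⟨fun hZ => ?_, fun hX => ?_⟩
  · exact pialtConclusion_of_finite_universallyInjective_surjective (ι ≫ Limits.pullback.snd F f) hZ
  · exact pialtConclusion_of_finite_universallyInjective_surjective_of_frobenius_finiteType p k hK
      _ X f (ι ≫ Limits.pullback.snd F f) (ι ≫ Limits.pullback.snd F f).surjective hN hX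

end Summit.ResolutionOfSingularities.ResolutionOfSingularities.Theorems

end
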